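import Summits.ABC.IUTFork.Cor312GenuineKTwistLowerBound
import Literature.IUT.LogVolume.GenuineThetaFieldLegendreTwist
import Literature.NumberTheory.EllipticCurves.MultiplicativeReductionC4ValuationProofs
import Literature.IUT.LogVolume.Theorem110GenuineStepIIPinned
import Literature.IUT.LogVolume.Corollary22PartIILemmas
import Literature.NumberTheory.DiophantineGeometry.AbcWave0UniformABCProofs
import HarnessLib

/-!
# [IUTchIII] Cor. 3.12, branch C / R-W window table — the TWIST factor `2` of the lower local type is UNCONDITIONAL:
# `ord_p(λ) < 0` odd (`p ≠ 2`, `j(λ) ≠ 1728`) ⟹ `2 ∣ e(w | p)` at every place `w ∣ p` of `T.F` and `2 ∣ e(K_{x₀}/ℚ_p)` at every fibre point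

PROOF-ONLY support file (D-0012; 0 definitions, 0 `Prop` facts) of the abc-iut cell (R-W «WINDOW Θ-SIDE INEQUALITY», seat
abc-iut-w4-d107 gen 7, row «W:LBt-UNCONDITIONAL»). TAKES NO SIDE on [IUTchIII] Cor. 3.12 (S. Mochizuki, *Inter-universal
Teichmüller theory III*, RIMS manuscript, Cor. 3.12 p. 173–174) or on any author.

THE POINT. abc-iut-W-neg-2's `Cor312GenuineKTwistLowerBound` (p475369) states the «twist factor `2`» of the inhabited-route input
«LBt» of the R-W numerics (HOME/plan/rescue/R-W/OPEN-INHABITED-ROUTE.tsv) under the MODEL clause `IsSquare (algebraMap ℚ F y)`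
(`√λ ∈ F`), noting that the typed datum `Cor22.ThetaVolumeDatumAt (ratPoint λ) l` pins `E_F` only by `j(E_F) = j(λ)`. By THIS
SEAT's `Cor22.ThetaVolumeDatumAt.exists_variableChange_thetaCurve_ratPoint` (Literature file `GenuineThetaFieldLegendreTwist`)
the three printed clauses `j(E_F) = j(λ)`, `E_F[30] ⊆ E_F(F)`, `F ⊆ F‡(λ)` (`IsSubThetaField`) already force
**`E_F ≅_F E_λ ⊗ F`** at a RATIONAL point with `j(λ) ≠ 1728`. Hence, with NO model clause:

* `Conditional.GenuineK.two_dvd_ramificationIdx_F_of_odd_pole` — `p ≠ 2` prime, `ord_p(λ) < 0` ODD (e.g. `λ = a/c` at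
  `p ∣ c` with `v_p(c)` odd): **`2 ∣ e(w | p)`** for every place `w ∣ p` of `T.F`. Proof: `w` lies over a bad place of `λ`
  (`ord_p j(λ) = 2·ord_p(λ) < 0`), so the semistable `T.E` is multiplicative at `w`
  (`hasMultiplicativeReductionAt_of_isSemistable_of_j_eq`), hence **`4 ∣ ord_w c₄(T.E)`** (this seat's
  `WeierstrassCurve.four_dvd_log_valuation_c₄_of_hasMultiplicativeReductionAt`, Silverman *AEC* VII.5.1 (b) + III.1 Table 3.1);
  `c₄(T.E) = u⁻⁴·c₄(E_λ ⊗ F)` for the `F`-rational change of variables, and `c₄(E_λ) = 16(λ² − λ + 1)` has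
  `ord_w = e(w|p)·2·ord_p(λ)`; so `2 ∣ e(w|p)·ord_p(λ)` with `ord_p(λ)` odd;
* `Conditional.GenuineK.two_dvd_absRamificationIdx_kOf_of_odd_pole` — fibre form **`2 ∣ e(K_{x₀}/ℚ_p)`** at every fibre point
  `x₀ ∣ p` of `pilotDataOfK T.D T.K`;
* `Conditional.GenuineK.two_mul_prime_dvd_absRamificationIdx_kOf_of_odd_pole` — with abc-iut-W-neg-1's exact factor `l`
  (`p ∉ {2, l}`): **`2·l ∣ e(K_{x₀}/ℚ_p)`**;
* `Conditional.GenuineK.thirty_mul_prime_dvd_absRamificationIdx_kOf_mul_of_odd_pole` — with the Tate root (abc-iut-W-neg-1's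
  `15·l ∣ e·t`): `ord_p j(λ) = −2t` ⟹ **`30·l ∣ e(K_{x₀}/ℚ_p)·t`** = the numerics lead's tame level-2 bound «LBv + LBt»,
  now a THEOREM of the typed datum at every such `(λ, p)`.

HONEST FRAMING: bookkeeping over OUR typed objects; nothing here bears on the printed inequality of [IUTchIII] Cor. 3.12 or on the
number-level `Cor22.Cor312AtDatum`; typed ≠ proved; instantiated ≠ endorsed; no abc claim.
[cite: Mochizuki2012, IUTchIV Thm. 1.10 p. 22, Cor. 2.2 (ii) proof (P5) p. 46; IUTchI Def. 3.1 (b) p. 61, Ex. 3.2 (iv) p. 71]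
[cite: SilvermanAEC2009, Prop. VII.5.1(b), III.1 Table 3.1, Prop. X.5.4] [cite: NeukirchANT1999, Ch. II Prop. (6.8)]
[claim: Mochizuki2012, status: disputed] for every IUT quotation.
-/

noncomputable section

open NumberField IsDedekindDomain

namespace Summit.ABC.IUTFork.Conditional

open Thm311 Thm311.Real Cor312 Cor312Prov Literature.IUT.LogVolume Literature.IUT.HodgeTheaters
  Literature.IUT.LogThetaLattice Literature.NumberTheory.NumberFields Literature.NumberTheory.DiophantineGeometry.GenEll
  Literature.NumberTheory.DiophantineGeometry

/-! ## §0. Valuation bookkeeping over `ℚ`: `ord_p(16(λ²−λ+1)) = 2·ord_p(λ)` and `ord_p j(λ) < 0` at a pole of `λ`, `p ≠ 2` -/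

/-- `ord_v(−x) = ord_v(x)`. [folklore] -/
private theorem ord_neg' {F : Type} [Field F] [NumberField F] (v : HeightOneSpectrum (𝓞 F)) (x : F) :
    Literature.IUT.LogVolume.ord F v (-x) = Literature.IUT.LogVolume.ord F v x := by
  unfold Literature.IUT.LogVolume.ord; rw [Valuation.map_neg]

/-- Ultrametric bookkeeping: `ord_v(x + y) = ord_v(x)` when `x ≠ 0` and `ord_v(x) < ord_v(y)`. [folklore] -/
private theorem ord_add_eq_left_of_lt {F : Type} [Field F] [NumberField F] (v : HeightOneSpectrum (𝓞 F)) {x y : F}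
    (hx : x ≠ 0) (h : Literature.IUT.LogVolume.ord F v x < Literature.IUT.LogVolume.ord F v y) :
    Literature.IUT.LogVolume.ord F v (x + y) = Literature.IUT.LogVolume.ord F v x := by
  by_cases hy : y = 0
  · rw [hy, add_zero]
  unfold Literature.IUT.LogVolume.ord at h ⊢
  have hvx : v.valuation F x ≠ 0 := (Valuation.ne_zero_iff _).mpr hx
  have hvy : v.valuation F y ≠ 0 := (Valuation.ne_zero_iff _).mpr hy
  have hlt : v.valuation F y < v.valuation F x := by
    rw [← WithZero.log_lt_log hvy hvx]; omega
  rw [Valuation.map_add_eq_of_lt_left _ hlt]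

/-- `ord_v(n) = 0` for a natural number `n` prime to the residue characteristic of the place `v` of `ℚ`. [folklore] -/
private theorem ord_rat_natCast_eq_zero (v : HeightOneSpectrum (𝓞 ℚ)) {n : ℕ}
    (h : ¬ Rat.HeightOneSpectrum.natGenerator v ∣ n) : Literature.IUT.LogVolume.ord ℚ v (n : ℚ) = 0 := by
  unfold Literature.IUT.LogVolume.ord
  rw [(UniformABCConjecture.valuation_natCast_eq_one_iff v n).2 h, WithZero.log_one, neg_zero]

/-- A power of `2` has `ord_v = 0` at a place of `ℚ` of odd residue characteristic. [folklore] -/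
private theorem ord_rat_two_pow_eq_zero (v : HeightOneSpectrum (𝓞 ℚ)) (hv2 : Rat.HeightOneSpectrum.natGenerator v ≠ 2)
    (k : ℕ) : Literature.IUT.LogVolume.ord ℚ v ((2 : ℚ) ^ k) = 0 := by
  have h : ¬ Rat.HeightOneSpectrum.natGenerator v ∣ 2 ^ k := fun hd =>
    hv2 ((Nat.prime_dvd_prime_iff_eq (Rat.HeightOneSpectrum.prime_natGenerator v) Nat.prime_two).1
      ((Rat.HeightOneSpectrum.prime_natGenerator v).dvd_of_dvd_pow hd))
  have := ord_rat_natCast_eq_zero v h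
  push_cast at this
  exact this

/-- **At a pole of `λ` away from `2`: `ord_p(16(λ² − λ + 1)) = 2·ord_p(λ)` and `ord_p j(λ) = 2·ord_p(λ) < 0`**
(`j(λ) = 2⁸(λ²−λ+1)³/(λ²(λ−1)²)`; `λ²` is the dominant term). [cite: SilvermanAEC2009, Prop. III.1.7(b)] -/
private theorem ord_c4_and_jInv_of_ord_neg (v : HeightOneSpectrum (𝓞 ℚ)) (hv2 : Rat.HeightOneSpectrum.natGenerator v ≠ 2)
    {q : ℚ} (hq : Literature.IUT.LogVolume.ord ℚ v q < 0) :
    Literature.IUT.LogVolume.ord ℚ v (16 * (q ^ 2 - q + 1)) = 2 * Literature.IUT.LogVolume.ord ℚ v q ∧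
      Literature.IUT.LogVolume.ord ℚ v (Cor22.jInv q) = 2 * Literature.IUT.LogVolume.ord ℚ v q := by
  have hq0 : q ≠ 0 := by
    intro h; rw [h, Literature.IUT.LogVolume.ord_zero] at hq; exact lt_irrefl _ hq
  have hq1 : q - 1 ≠ 0 := by
    intro h; have h' : q = 1 := by linarith
    rw [h', Literature.IUT.LogVolume.ord_one] at hq; exact lt_irrefl _ hq
  have hpos : (0 : ℚ) < q ^ 2 - q + 1 := by nlinarith [sq_nonneg (2 * q - 1)]
  have hquad0 : q ^ 2 - q + 1 ≠ 0 := hpos.ne'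
  have hone : Literature.IUT.LogVolume.ord ℚ v (-1) = 0 := by rw [ord_neg', Literature.IUT.LogVolume.ord_one]
  -- `ord(−q + 1) = ord(q − 1) = ord(q)`, `ord(q² − q + 1) = 2·ord(q)`
  have hneg1 : Literature.IUT.LogVolume.ord ℚ v (-q + 1) = Literature.IUT.LogVolume.ord ℚ v q := by
    rw [ord_add_eq_left_of_lt v (neg_ne_zero.mpr hq0)
      (by rw [ord_neg', Literature.IUT.LogVolume.ord_one]; exact hq), ord_neg']
  have hsub1 : Literature.IUT.LogVolume.ord ℚ v (q - 1) = Literature.IUT.LogVolume.ord ℚ v q := by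
    rw [sub_eq_add_neg, ord_add_eq_left_of_lt v hq0 (by rw [hone]; exact hq)]
  have hsq : Literature.IUT.LogVolume.ord ℚ v (q ^ 2) = 2 * Literature.IUT.LogVolume.ord ℚ v q := by
    rw [Literature.IUT.LogVolume.ord_pow]; push_cast; ring
  have hquad : Literature.IUT.LogVolume.ord ℚ v (q ^ 2 - q + 1) = 2 * Literature.IUT.LogVolume.ord ℚ v q := by
    rw [show q ^ 2 - q + 1 = q ^ 2 + (-q + 1) by ring,
      ord_add_eq_left_of_lt v (pow_ne_zero 2 hq0) (by rw [hsq, hneg1]; omega), hsq]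
  refine ⟨?_, ?_⟩
  · rw [Literature.IUT.LogVolume.ord_mul ℚ v (by norm_num) hquad0, show (16 : ℚ) = 2 ^ 4 by norm_num,
      ord_rat_two_pow_eq_zero v hv2, hquad, zero_add]
  · unfold Cor22.jInv
    rw [div_eq_mul_inv, Literature.IUT.LogVolume.ord_mul ℚ v (mul_ne_zero (by norm_num) (pow_ne_zero 3 hquad0))
        (inv_ne_zero (mul_ne_zero (pow_ne_zero 2 hq0) (pow_ne_zero 2 hq1))),
      Literature.IUT.LogVolume.ord_mul ℚ v (by norm_num) (pow_ne_zero 3 hquad0), Literature.IUT.LogVolume.ord_inv,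
      Literature.IUT.LogVolume.ord_mul ℚ v (pow_ne_zero 2 hq0) (pow_ne_zero 2 hq1), ord_rat_two_pow_eq_zero v hv2,
      Literature.IUT.LogVolume.ord_pow, Literature.IUT.LogVolume.ord_pow, Literature.IUT.LogVolume.ord_pow, hquad, hsub1]
    push_cast
    ring

/-! ## §1. `2 ∣ e(w | p)` at the places of `F` over an odd pole of `λ` — NO model clause -/

/-- **UNCONDITIONAL TWIST FACTOR `2`.** For a genuine Θ-volume datum `T` over a rational point `λ = q` with `j(q) ≠ 1728`, a prime
`p ≠ 2` with `ord_p(q) = −t`, `t` ODD, and every place `w ∣ p` of `F = T.F`: **`2 ∣ e(w | p)`**. (`T.E ≅_F E_q ⊗ F` by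
`Cor22.ThetaVolumeDatumAt.exists_variableChange_thetaCurve_ratPoint'`; `T.E` is multiplicative at the bad place `w`, so
`4 ∣ ord_w c₄(T.E) ≡ ord_w c₄(E_q) = e(w|p)·2·ord_p(q) (mod 4)`.) Compare abc-iut-W-neg-2's
`GenuineK.two_dvd_ramificationIdx_F_of_isSquare` (same conclusion under `√y ∈ F`).
[cite: SilvermanAEC2009, Prop. VII.5.1(b) and III.1 Table 3.1] [cite: NeukirchANT1999, Ch. II Prop. (6.8)]
[cite: Mochizuki2012, IUTchIV Thm. 1.10 p. 22] [claim: Mochizuki2012, status: disputed] -/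
theorem GenuineK.two_dvd_ramificationIdx_F_of_odd_pole {q : ℚ} {l : ℕ} (T : Cor22.ThetaVolumeDatumAt (ratPoint q) l)
    (hj : Cor22.jInv q ≠ 1728) (pp : Nat.Primes) (hp2 : (pp : ℕ) ≠ 2) {t : ℕ} (ht : Odd t)
    (hordq : ∀ v : HeightOneSpectrum (𝓞 ℚ), Rat.HeightOneSpectrum.natGenerator v = pp →
      Literature.IUT.LogVolume.ord ℚ v q = -(t : ℤ))
    (w : letI := T.instFieldF; letI := T.instNumberFieldF; HeightOneSpectrum (𝓞 T.F))
    (hw : letI := T.instFieldF; letI := T.instNumberFieldF; ((pp : ℕ) : 𝓞 T.F) ∈ w.asIdeal) :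
    2 ∣ (letI := T.instFieldF; letI := T.instNumberFieldF; w.asIdeal.ramificationIdx ℤ) := by
  letI := T.instFieldF; letI := T.instNumberFieldF; letI := T.instAlgebraF; letI := T.instFieldK
  letI := T.instNumberFieldK; letI := T.instAlgebraK; letI := T.instFieldFbar; letI := T.instAlgebraFbar
  letI := T.instAlgebraKFbar; letI := T.instIsElliptic
  haveI : Fact (pp : ℕ).Prime := ⟨pp.2⟩
  -- the place of `ℚ` under `w` is `p`
  set v : HeightOneSpectrum (𝓞 ℚ) := finBelow (ratPoint q).F T.F w with hvdef
  have hwchar : residueChar T.F w = (pp : ℕ) := residueChar_eq_of_natCast_mem pp.1 hw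
  have hvp : Rat.HeightOneSpectrum.natGenerator v = pp := by
    have hchar : residueChar ℚ v = pp := by
      rw [hvdef]
      change residueChar (ratPoint q).F (finBelow (ratPoint q).F T.F w) = pp
      rw [residueChar_finBelow, hwchar]
    have hmem : ((pp : ℕ) : 𝓞 ℚ) ∈ v.asIdeal := by
      rw [Cor22.natCast_mem_asIdeal_iff_residueChar_eq v pp.2]; exact hchar
    have hdvd := (UniformABCConjecture.natCast_mem_asIdeal_iff v pp).1 hmem
    exact (Nat.prime_dvd_prime_iff_eq (Rat.HeightOneSpectrum.prime_natGenerator v) pp.2).1 hdvd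
  have hneg : Literature.IUT.LogVolume.ord ℚ v q < 0 := by rw [hordq v hvp]; have := ht.pos; omega
  have hoddq : Odd (Literature.IUT.LogVolume.ord ℚ v q) := by rw [hordq v hvp]; exact ((Int.odd_coe_nat t).mpr ht).neg
  have hv2 : Rat.HeightOneSpectrum.natGenerator v ≠ 2 := by rw [hvp]; exact hp2
  obtain ⟨hordc, hordj⟩ := ord_c4_and_jInv_of_ord_neg v hv2 hneg
  -- `w` lies over a BAD place of `λ`, so the semistable `T.E` is multiplicative at `w`
  have hbad : finBelow (ratPoint q).F T.F w ∈ Cor22.badPlaces (ratPoint q) := by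
    rw [Cor22.mem_badPlaces_iff_ord_neg]
    change Literature.IUT.LogVolume.ord ℚ v (Cor22.jInv q) < 0
    rw [hordj]; omega
  have hmult : T.E.HasMultiplicativeReductionAt w :=
    Cor22.hasMultiplicativeReductionAt_of_isSemistable_of_j_eq T.F T.D.isSemistable T.j_eq w hbad
  -- `4 ∣ ord_w c₄(T.E)`
  obtain ⟨hc40, h4⟩ := WeierstrassCurve.four_dvd_log_valuation_c₄_of_hasMultiplicativeReductionAt w T.E hmult
  have h4' : (4 : ℤ) ∣ Literature.IUT.LogVolume.ord T.F w T.E.c₄ := by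
    unfold Literature.IUT.LogVolume.ord; exact (dvd_neg).mpr h4
  -- `T.E = C₁ • E_q` over `F`, so `c₄(T.E) = u⁻⁴ · c₄(E_q)` with `c₄(E_q) = 16(q² − q + 1)`
  obtain ⟨C₁, hC₁⟩ := T.exists_variableChange_thetaCurve_ratPoint' hj
  have hΘc₄ : ∀ (P : NFPoint) (F : Type) [Field F] [NumberField F] [Algebra P.F F],
      (Cor22.thetaCurve P F).c₄ = algebraMap P.F F (16 * (P.x ^ 2 - P.x + 1)) := by
    intro P F _ _ _
    simp only [WeierstrassCurve.c₄, WeierstrassCurve.b₂, WeierstrassCurve.b₄, map_mul, map_add, map_sub, map_pow, map_one,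
      map_ofNat]
    ring
  set c : ℚ := 16 * (q ^ 2 - q + 1) with hcdef
  have hc0 : c ≠ 0 := by
    have : (0 : ℚ) < q ^ 2 - q + 1 := by nlinarith [sq_nonneg (2 * q - 1)]
    positivity
  have hc₄ : T.E.c₄ = ((C₁.u⁻¹ : T.Fˣ) : T.F) ^ 4 * algebraMap (ratPoint q).F T.F c := by
    rw [← hC₁, WeierstrassCurve.variableChange_c₄, hΘc₄]; rfl
  have hu0 : ((C₁.u⁻¹ : T.Fˣ) : T.F) ≠ 0 := (C₁.u⁻¹).ne_zero
  have hcF0 : algebraMap (ratPoint q).F T.F c ≠ 0 := (map_ne_zero_iff _ (algebraMap (ratPoint q).F T.F).injective).mpr hc0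
  have hordE : Literature.IUT.LogVolume.ord T.F w T.E.c₄ =
      4 * Literature.IUT.LogVolume.ord T.F w ((C₁.u⁻¹ : T.Fˣ) : T.F) +
        Literature.IUT.LogVolume.ord T.F w (algebraMap (ratPoint q).F T.F c) := by
    rw [hc₄, Literature.IUT.LogVolume.ord_mul T.F w (pow_ne_zero 4 hu0) hcF0, Literature.IUT.LogVolume.ord_pow]; push_cast; ring
  have h4c : (4 : ℤ) ∣ Literature.IUT.LogVolume.ord T.F w (algebraMap (ratPoint q).F T.F c) := by
    have := dvd_sub h4' (dvd_mul_right 4 (Literature.IUT.LogVolume.ord T.F w ((C₁.u⁻¹ : T.Fˣ) : T.F)))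
    rw [hordE] at this
    simpa using this
  -- `ord_w(c) = e(w|v)·ord_v(c) = e(w|v)·2·ord_v(q)`
  have h1 := Cor22.ord_algebraMap_eq (F := (ratPoint q).F) (K := T.F) w c
  have h1' : Literature.IUT.LogVolume.ord T.F w (algebraMap (ratPoint q).F T.F c) =
      ((finBelow (ratPoint q).F T.F w).asIdeal.ramificationIdx' w.asIdeal : ℤ) *
        (2 * Literature.IUT.LogVolume.ord ℚ v q) := by
    rw [h1]
    congr 1
  rw [h1'] at h4c
  -- hence `e(w|v)` is even (`ord_v(q)` odd)
  have heven : Even (((finBelow (ratPoint q).F T.F w).asIdeal.ramificationIdx' w.asIdeal : ℤ)) := by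
    have h2 : (2 : ℤ) ∣ ((finBelow (ratPoint q).F T.F w).asIdeal.ramificationIdx' w.asIdeal : ℤ) *
        Literature.IUT.LogVolume.ord ℚ v q := by
      have h := h4c
      rw [show ((finBelow (ratPoint q).F T.F w).asIdeal.ramificationIdx' w.asIdeal : ℤ) *
          (2 * Literature.IUT.LogVolume.ord ℚ v q) =
          2 * (((finBelow (ratPoint q).F T.F w).asIdeal.ramificationIdx' w.asIdeal : ℤ) *
            Literature.IUT.LogVolume.ord ℚ v q) by ring, show (4 : ℤ) = 2 * 2 by norm_num] at h
      exact (mul_dvd_mul_iff_left two_ne_zero).mp h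
    rcases Int.even_mul.mp (even_iff_two_dvd.mpr h2) with he | he
    · exact he
    · exact absurd he (Int.not_even_iff_odd.mpr hoddq)
  have heven' : 2 ∣ (finBelow (ratPoint q).F T.F w).asIdeal.ramificationIdx' w.asIdeal := by
    have := even_iff_two_dvd.mp heven
    exact_mod_cast this
  -- `e(w | p) = e(w | v)` over `ℚ`
  have hew : w.asIdeal.ramificationIdx ℤ = (finBelow (ratPoint q).F T.F w).asIdeal.ramificationIdx' w.asIdeal := by
    have h1'' : ramIdx (ratPoint q).F (w.under (𝓞 (ratPoint q).F)) = 1 := by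
      rw [ramIdx_eq]
      exact Literature.NumberTheory.EllipticCurves.Fisher2016.ramificationIdx_int_rat_eq_one _
    rw [ThetaData.absRamificationIdx_eq_ramIdx_mul (F := (ratPoint q).F) w]
    erw [h1'', one_mul]
    rfl
  rw [hew]; exact heven'

/-! ## §2. Fibre forms at the `K`-level pilot datum `pilotDataOfK T.D T.K` -/

/-- **Fibre form: `2 ∣ e(K_{x₀}/ℚ_p)` at EVERY fibre point `x₀ ∣ p`** of the `K`-level pilot datum, for `p ≠ 2` with
`ord_p(q) = −t`, `t` odd, `j(q) ≠ 1728` (`e(K_{x₀}/ℚ_p) = e(w | p)·e(x₀ | w)`, `w = x₀ ∩ 𝓞_F`). The «twist factor `2`» of the R-W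
numerics (`q = a/c` at `p ∣ c`, `v_p(c)` odd), with NO model clause. [cite: NeukirchANT1999, Ch. II Prop. (6.8)]
[cite: Mochizuki2012, IUTchIV Thm. 1.10 p. 22] [claim: Mochizuki2012, status: disputed] -/
theorem GenuineK.two_dvd_absRamificationIdx_kOf_of_odd_pole {q : ℚ} {l : ℕ} (T : Cor22.ThetaVolumeDatumAt (ratPoint q) l)
    (hj : Cor22.jInv q ≠ 1728) (pp : Nat.Primes) (hp2 : (pp : ℕ) ≠ 2) {t : ℕ} (ht : Odd t)
    (hordq : ∀ v : HeightOneSpectrum (𝓞 ℚ), Rat.HeightOneSpectrum.natGenerator v = pp →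
      Literature.IUT.LogVolume.ord ℚ v q = -(t : ℤ)) :
    letI := T.instFieldF; letI := T.instNumberFieldF; letI := T.instAlgebraF; letI := T.instFieldK
    letI := T.instNumberFieldK; letI := T.instAlgebraK; letI := T.instFieldFbar; letI := T.instAlgebraFbar
    letI := T.instAlgebraKFbar; letI := T.instIsElliptic
    haveI : Fact (pp : ℕ).Prime := ⟨pp.2⟩
    ∀ x₀ : (thetaIndex (pilotDataOfK T.D T.K)).Fibre (.inr pp),
      2 ∣ absRamificationIdx (pp : ℕ) (kOf (pilotDataOfK T.D T.K) pp.1 x₀) := by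
  letI := T.instFieldF; letI := T.instNumberFieldF; letI := T.instAlgebraF; letI := T.instFieldK
  letI := T.instNumberFieldK; letI := T.instAlgebraK; letI := T.instFieldFbar; letI := T.instAlgebraFbar
  letI := T.instAlgebraKFbar; letI := T.instIsElliptic
  haveI : Fact (pp : ℕ).Prime := ⟨pp.2⟩
  set X := pilotDataOfK T.D T.K with hXdef
  intro x₀
  set u := placeOf X pp.1 x₀ with hudef
  have hpu : ((pp : ℕ) : 𝓞 T.K) ∈ u.asIdeal := natCast_mem_placeOf X pp.1 x₀
  have hekOf : absRamificationIdx (pp : ℕ) (kOf X pp.1 x₀) = u.asIdeal.ramificationIdx ℤ := by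
    rw [show absRamificationIdx (pp : ℕ) (kOf X pp.1 x₀) =
        absRamificationIdx (pp : ℕ) (RescaledCompletion T.K pp.1 (placeOf X pp.1 x₀) hpu) from rfl,
      absRamificationIdx_rescaledCompletion]
  have hpw : ((pp : ℕ) : 𝓞 T.F) ∈ (finBelow T.F T.K u).asIdeal := by
    change ((pp : ℕ) : 𝓞 T.F) ∈ Ideal.comap (algebraMap (𝓞 T.F) (𝓞 T.K)) u.asIdeal
    rw [Ideal.mem_comap, map_natCast]
    exact hpu
  have hF : 2 ∣ (finBelow T.F T.K u).asIdeal.ramificationIdx ℤ :=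
    GenuineK.two_dvd_ramificationIdx_F_of_odd_pole T hj pp hp2 ht hordq (finBelow T.F T.K u) hpw
  rw [hekOf, ThetaData.absRamificationIdx_eq_ramIdx_mul (F := T.F) u, ramIdx_eq]
  exact dvd_mul_of_dvd_left hF _

/-- At such `p`, every place of `ℚ` over `p` is a POLE of `j(q)` of order `2t`: `ord_p j(q) = 2·ord_p(q) = −2t`. [folklore] -/
private theorem ord_jInv_eq_of_ordq {q : ℚ} (pp : Nat.Primes) (hp2 : (pp : ℕ) ≠ 2) {t : ℕ} (ht : Odd t)
    (hordq : ∀ v : HeightOneSpectrum (𝓞 ℚ), Rat.HeightOneSpectrum.natGenerator v = pp →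
      Literature.IUT.LogVolume.ord ℚ v q = -(t : ℤ))
    (v : HeightOneSpectrum (𝓞 ℚ)) (hv : Rat.HeightOneSpectrum.natGenerator v = pp) :
    Literature.IUT.LogVolume.ord ℚ v (Cor22.jInv q) = -(2 * (t : ℤ)) := by
  have hneg : Literature.IUT.LogVolume.ord ℚ v q < 0 := by rw [hordq v hv]; have := ht.pos; omega
  have hv2 : Rat.HeightOneSpectrum.natGenerator v ≠ 2 := by rw [hv]; exact hp2
  rw [(ord_c4_and_jInv_of_ord_neg v hv2 hneg).2, hordq v hv]; ring

/-- **`2·l ∣ e(K_{x₀}/ℚ_p)` at every fibre point over such a prime `p ∉ {2, l}`**: the unconditional twist factor `2` times the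
exact `l` of the `l`-division layer (abc-iut-W-neg-1's `GenuineK.absRamificationIdx_kOf_eq_mul_prime_ratPoint`; `p` is a pole of
`j(q)` since `ord_p j(q) = −2t`). [cite: Mochizuki2012, IUTchI Ex. 3.2 (iv) p. 71] [claim: Mochizuki2012, status: disputed] -/
theorem GenuineK.two_mul_prime_dvd_absRamificationIdx_kOf_of_odd_pole {q : ℚ} {l : ℕ}
    (T : Cor22.ThetaVolumeDatumAt (ratPoint q) l) (hj : Cor22.jInv q ≠ 1728) (pp : Nat.Primes) (hp2 : (pp : ℕ) ≠ 2)
    (hpl : (pp : ℕ) ≠ l) {t : ℕ} (ht : Odd t)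
    (hordq : ∀ v : HeightOneSpectrum (𝓞 ℚ), Rat.HeightOneSpectrum.natGenerator v = pp →
      Literature.IUT.LogVolume.ord ℚ v q = -(t : ℤ)) :
    letI := T.instFieldF; letI := T.instNumberFieldF; letI := T.instAlgebraF; letI := T.instFieldK
    letI := T.instNumberFieldK; letI := T.instAlgebraK; letI := T.instFieldFbar; letI := T.instAlgebraFbar
    letI := T.instAlgebraKFbar; letI := T.instIsElliptic
    haveI : Fact (pp : ℕ).Prime := ⟨pp.2⟩
    ∀ x₀ : (thetaIndex (pilotDataOfK T.D T.K)).Fibre (.inr pp),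
      2 * l ∣ absRamificationIdx (pp : ℕ) (kOf (pilotDataOfK T.D T.K) pp.1 x₀) := by
  letI := T.instFieldF; letI := T.instNumberFieldF; letI := T.instAlgebraF; letI := T.instFieldK
  letI := T.instNumberFieldK; letI := T.instAlgebraK; letI := T.instFieldFbar; letI := T.instAlgebraFbar
  letI := T.instAlgebraKFbar; letI := T.instIsElliptic
  haveI : Fact (pp : ℕ).Prime := ⟨pp.2⟩
  set X := pilotDataOfK T.D T.K with hXdef
  intro x₀
  have hpole : ∀ v : HeightOneSpectrum (𝓞 ℚ), Rat.HeightOneSpectrum.natGenerator v = pp →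
      Literature.IUT.LogVolume.ord ℚ v (Cor22.jInv q) < 0 := fun v hv => by
    rw [ord_jInv_eq_of_ordq pp hp2 ht hordq v hv]; have := ht.pos; omega
  rw [GenuineK.absRamificationIdx_kOf_eq_mul_prime_ratPoint T pp hp2 hpl hpole x₀]
  set u := placeOf X pp.1 x₀ with hudef
  have hpu : ((pp : ℕ) : 𝓞 T.K) ∈ u.asIdeal := natCast_mem_placeOf X pp.1 x₀
  have hpw : ((pp : ℕ) : 𝓞 T.F) ∈ (finBelow T.F T.K u).asIdeal := by
    change ((pp : ℕ) : 𝓞 T.F) ∈ Ideal.comap (algebraMap (𝓞 T.F) (𝓞 T.K)) u.asIdeal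
    rw [Ideal.mem_comap, map_natCast]
    exact hpu
  exact mul_dvd_mul (GenuineK.two_dvd_ramificationIdx_F_of_odd_pole T hj pp hp2 ht hordq (finBelow T.F T.K u) hpw) dvd_rfl

/-- Arithmetic glue: `l ∣ e`, `2·l ∣ e` and `15·l ∣ e·t` give `30·l ∣ e·t`. [folklore] -/
private theorem thirty_mul_dvd_of_dvd' {l e t : ℕ} (hl : 0 < l) (hle : l ∣ e) (h2 : 2 * l ∣ e)
    (h15 : 15 * l ∣ e * t) : 30 * l ∣ e * t := by
  obtain ⟨e₁, rfl⟩ := hle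
  have h2' : 2 ∣ e₁ := by
    have : l * 2 ∣ l * e₁ := by rw [mul_comm l 2]; exact h2
    exact Nat.dvd_of_mul_dvd_mul_left hl this
  have h15' : 15 ∣ e₁ * t := by
    have : l * 15 ∣ l * (e₁ * t) := by rw [mul_comm l 15, ← mul_assoc]; exact h15
    exact Nat.dvd_of_mul_dvd_mul_left hl this
  have h : 2 * 15 ∣ e₁ * t := (by norm_num : Nat.Coprime 2 15).mul_dvd_of_dvd_of_dvd (dvd_mul_of_dvd_left h2' t) h15'
  rw [show 30 * l = l * (2 * 15) by ring, show l * e₁ * t = l * (e₁ * t) by ring]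
  exact mul_dvd_mul_left l h

/-- **`30·l ∣ e(K_{x₀}/ℚ_p)·t` at every fibre point over such a prime `p ∉ {2, l}`** (`ord_p(q) = −t`, `t` odd, `j(q) ≠ 1728`): the
Tate-root factor `15/gcd(15,t)` (abc-iut-W-neg-1's `GenuineK.fifteen_mul_prime_dvd_absRamificationIdx_kOf_mul_ratPoint`), the
unconditional twist factor `2` and the exact `l` — the R-W numerics lead's tame level-2 lower bound «LBv + LBt»
`lcm(15/gcd(15,t), 2)·l ∣ e`, now with NO model clause. [cite: SilvermanATAEC1994, V.5 Thm. 5.3 and Cor. 5.4]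
[cite: Mochizuki2012, IUTchIV Thm. 1.10 p. 22] [claim: Mochizuki2012, status: disputed] -/
theorem GenuineK.thirty_mul_prime_dvd_absRamificationIdx_kOf_mul_of_odd_pole {q : ℚ} {l : ℕ}
    (T : Cor22.ThetaVolumeDatumAt (ratPoint q) l) (hj : Cor22.jInv q ≠ 1728) (pp : Nat.Primes) (hp2 : (pp : ℕ) ≠ 2)
    (hpl : (pp : ℕ) ≠ l) {t : ℕ} (ht : Odd t)
    (hordq : ∀ v : HeightOneSpectrum (𝓞 ℚ), Rat.HeightOneSpectrum.natGenerator v = pp →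
      Literature.IUT.LogVolume.ord ℚ v q = -(t : ℤ)) :
    letI := T.instFieldF; letI := T.instNumberFieldF; letI := T.instAlgebraF; letI := T.instFieldK
    letI := T.instNumberFieldK; letI := T.instAlgebraK; letI := T.instFieldFbar; letI := T.instAlgebraFbar
    letI := T.instAlgebraKFbar; letI := T.instIsElliptic
    haveI : Fact (pp : ℕ).Prime := ⟨pp.2⟩
    ∀ x₀ : (thetaIndex (pilotDataOfK T.D T.K)).Fibre (.inr pp),
      30 * l ∣ absRamificationIdx (pp : ℕ) (kOf (pilotDataOfK T.D T.K) pp.1 x₀) * t := by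
  letI := T.instFieldF; letI := T.instNumberFieldF; letI := T.instAlgebraF; letI := T.instFieldK
  letI := T.instNumberFieldK; letI := T.instAlgebraK; letI := T.instFieldFbar; letI := T.instAlgebraFbar
  letI := T.instAlgebraKFbar; letI := T.instIsElliptic
  haveI : Fact (pp : ℕ).Prime := ⟨pp.2⟩
  intro x₀
  have hpole : ∀ v : HeightOneSpectrum (𝓞 ℚ), Rat.HeightOneSpectrum.natGenerator v = pp →
      Literature.IUT.LogVolume.ord ℚ v (Cor22.jInv q) = -(2 * (t : ℤ)) := fun v hv =>
    ord_jInv_eq_of_ordq pp hp2 ht hordq v hv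
  have hpole' : ∀ v : HeightOneSpectrum (𝓞 ℚ), Rat.HeightOneSpectrum.natGenerator v = pp →
      Literature.IUT.LogVolume.ord ℚ v (Cor22.jInv q) < 0 := fun v hv => by
    rw [hpole v hv]; have := ht.pos; omega
  have hle := GenuineK.prime_dvd_absRamificationIdx_kOf_ratPoint T pp hp2 hpl hpole' x₀
  have h2 := GenuineK.two_mul_prime_dvd_absRamificationIdx_kOf_of_odd_pole T hj pp hp2 hpl ht hordq x₀
  have h15 := GenuineK.fifteen_mul_prime_dvd_absRamificationIdx_kOf_mul_ratPoint T pp hp2 hpl ht.pos hpole x₀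
  exact thirty_mul_dvd_of_dvd' T.D.l_prime.pos hle h2 h15

end Summit.ABC.IUTFork.Conditional

end
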